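import Literature.Probability.Percolation.RegionGluing
import Literature.Probability.Percolation.UniformPercolation
import Literature.Barriers.CriticalPhenomena.MassTransportPrinciple
import HarnessLib

/-!
# Mushroom transport I: the layer-ratio transport identity for half-space clusters

Solo seat `solo-CriticalPhenomena-informed`, portrait item S10 of `paper/sharpest-statement.md`
(kernel form of CLAIMS C23), part I (every `d`, every `p`); part II (`SoloInformedMushroomLimit`)
evaluates the identity at `p_c`. Notation: `ℍ = {x | 0 ≤ x₀}` (`halfSpace d`), `C_ℍ(x) = C_ℍ^ω(x)`
the open cluster of `x` computed inside `ℍ` (`openClusterIn (withinGraph (zdGraph d) (halfSpace d)) ω x`),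
`L_s = {z | z₀ = s}` the layers, `|·| = Set.encard` read in `ℝ≥0∞` (so `a / a = 1` iff `0 < a < ∞`).

* `lintegral_transport` — for EVERY `d`, `p` and `x ∈ ℤ^d`:
  `∫⁻ |L_0 ∩ C_ℍ(x)| / |L_0 ∩ C_ℍ(x)| dP_p = ∫⁻ |L_{x₀} ∩ C_ℍ(0)| / |L_0 ∩ C_ℍ(0)| dP_p`, i.e.
  (`measure_footprint_eq_lintegral_layerRatio`)
  `P_p(L_0 ∩ C_ℍ(x) is nonempty and finite) = E_p[|L_{x₀} ∩ C_ℍ(0)| / |L_0 ∩ C_ℍ(0)|]`;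
  in particular `E_p[|L_s ∩ C_ℍ(0)| / |L_0 ∩ C_ℍ(0)|] ≤ 1` (`lintegral_layerRatio_le_one`).

This is the mass-transport principle for the group `ℤ^{d-1}` of translations parallel to `∂ℍ`
(Lyons–Peres 2016, §8.1 with (8.4); tree: `Literature.Barriers.CriticalPhenomena.MassTransportPrinciple`):
`x' ∈ x + L_0` sends unit mass spread uniformly over its footprint `L_0 ∩ C_ℍ(x')` when that
footprint is finite and nonempty; the mass received by `0` is `|L_{x₀} ∩ C_ℍ(0)| / |L_0 ∩ C_ℍ(0)|`.
The abelian case needs no unimodularity bookkeeping: the proof is Tonelli, invariance of `P_p` and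
of `C_ℍ` under the translations `ω ↦ ω + y` (`y ∈ L_0`), and the reindexing `y ↦ x - y`. [folklore]
-/

noncomputable section

namespace Summit.CriticalPhenomena.PercolationContinuityZ3.Theorems

open MeasureTheory ProbabilityTheory Filter Topology
open Literature.Probability.Percolation Literature.Probability.LatticeModels
open scoped ENNReal

namespace Mushroom

variable {d : ℕ}

/-! ## Geometry of half-space clusters -/

/-- Membership in constrained clusters is symmetric. [folklore] -/
theorem mem_openClusterIn_comm {V : Type*} {K : SimpleGraph V} {ω : BondConfig V} {x y : V} :
    y ∈ openClusterIn K ω x ↔ x ∈ openClusterIn K ω y := by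
  rw [mem_openClusterIn_iff, mem_openClusterIn_iff]
  exact ⟨SimpleGraph.Reachable.symm, SimpleGraph.Reachable.symm⟩

/-- Two `ℤ^d`-neighbours on opposite sides of `∂ℍ`: the one inside `ℍ` lies on the layer `L_0`.
[folklore] -/
theorem apply_zero_eq_zero_of_adj [NeZero d] {a b : Site d} (h : (zdGraph d).Adj a b)
    (ha : 0 ≤ a 0) (hb : b 0 < 0) : a 0 = 0 := by
  obtain ⟨i, h | h⟩ := (zdGraph_adj_iff a b).1 h
  · have h0 := congrFun h 0
    simp only [Pi.add_apply, Pi.single_apply] at h0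
    split_ifs at h0 <;> omega
  · have h0 := congrFun h 0
    simp only [Pi.add_apply, Pi.single_apply] at h0
    split_ifs at h0 <;> omega

/-- Translating by a vector `v` parallel to `∂ℍ` (`v₀ = 0`) carries half-space clusters to
half-space clusters: `C_ℍ^{ω+v}(u) = C_ℍ^ω(u - v) + v`. [folklore] -/
theorem openClusterIn_halfSpace_shift [NeZero d] (v : Site d) (hv : v 0 = 0)
    (ω : BondConfig (Site d)) (u : Site d) :
    openClusterIn (withinGraph (zdGraph d) (halfSpace d))
        (BondConfig.relabel (sym2Equiv (Site.shift v)) ω) u =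
      (fun z => z + v) '' openClusterIn (withinGraph (zdGraph d) (halfSpace d)) ω (u - v) := by
  have hK : ∀ a b, (withinGraph (zdGraph d) (halfSpace d)).Adj (Site.shift v a) (Site.shift v b) ↔
      (withinGraph (zdGraph d) (halfSpace d)).Adj a b := by
    intro a b
    rw [withinGraph_adj, withinGraph_adj, zdGraph_adj_shift_iff]
    simp only [halfSpace, Set.mem_setOf_eq, Site.shift_apply, Pi.add_apply, hv, add_zero]
  have h := openClusterIn_relabel (Site.shift v) hK ω (u - v)
  rw [Site.shift_apply, sub_add_cancel] at h
  rw [h]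
  ext z
  simp only [Set.mem_image, Site.shift_apply]

/-- Layer footprints are translated along with the cluster (`v₀ = 0`). [folklore] -/
theorem layer_inter_openClusterIn_shift [NeZero d] (v : Site d) (hv : v 0 = 0)
    (ω : BondConfig (Site d)) (u : Site d) (s : ℤ) :
    {z : Site d | z 0 = s} ∩ openClusterIn (withinGraph (zdGraph d) (halfSpace d))
        (BondConfig.relabel (sym2Equiv (Site.shift v)) ω) u =
      (fun z => z + v) '' ({z : Site d | z 0 = s} ∩
        openClusterIn (withinGraph (zdGraph d) (halfSpace d)) ω (u - v)) := by
  rw [openClusterIn_halfSpace_shift v hv ω u]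
  ext z
  simp only [Set.mem_inter_iff, Set.mem_setOf_eq, Set.mem_image]
  constructor
  · rintro ⟨hz, w, hw, rfl⟩
    refine ⟨w, ⟨?_, hw⟩, rfl⟩
    simpa only [Pi.add_apply, hv, add_zero] using hz
  · rintro ⟨w, ⟨hw0, hw⟩, rfl⟩
    refine ⟨?_, w, hw, rfl⟩
    simp only [Pi.add_apply, hv, add_zero, hw0]

/-- Hence layer counts are translation invariant: `|L_s ∩ C_ℍ^{ω+v}(u)| = |L_s ∩ C_ℍ^ω(u - v)|`
(`v₀ = 0`). [folklore] -/
theorem encard_layer_shift [NeZero d] (v : Site d) (hv : v 0 = 0) (ω : BondConfig (Site d))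
    (u : Site d) (s : ℤ) :
    ({z : Site d | z 0 = s} ∩ openClusterIn (withinGraph (zdGraph d) (halfSpace d))
        (BondConfig.relabel (sym2Equiv (Site.shift v)) ω) u).encard =
      ({z : Site d | z 0 = s} ∩
        openClusterIn (withinGraph (zdGraph d) (halfSpace d)) ω (u - v)).encard := by
  rw [layer_inter_openClusterIn_shift v hv ω u s, (add_left_injective v).encard_image]

/-! ## Layer counts in `ℝ≥0∞`: indicator sums and measurability -/

/-- `|S|` read in `ℝ≥0∞` is the sum of the indicator of `S`. [folklore] -/
theorem encard_eq_tsum_indicator {α : Type*} (S : Set α) :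
    ((S.encard : ℕ∞) : ℝ≥0∞) = ∑' z, S.indicator (fun _ => (1 : ℝ≥0∞)) z := by
  rw [Literature.Barriers.CriticalPhenomena.tsum_indicator_const, mul_one]

/-- `|S| / |S| = 1` in `ℝ≥0∞` for a nonempty finite `S`. [folklore] -/
theorem encard_div_self_eq_one {α : Type*} {S : Set α} (h₁ : S.Nonempty) (h₂ : S.Finite) :
    ((S.encard : ℕ∞) : ℝ≥0∞) / ((S.encard : ℕ∞) : ℝ≥0∞) = 1 := by
  refine ENNReal.div_self ?_ ?_
  · rw [ne_eq, ENat.toENNReal_eq_zero, Set.encard_eq_zero]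
    exact h₁.ne_empty
  · rw [ne_eq, ENat.toENNReal_eq_top, Set.encard_eq_top_iff]
    exact h₂.not_infinite

/-- `|S| / |S| = 0` in `ℝ≥0∞` when `S` is empty or infinite (`0 / 0 = ∞ / ∞ = 0`). [folklore] -/
theorem encard_div_self_eq_zero {α : Type*} {S : Set α} (h : ¬ (S.Nonempty ∧ S.Finite)) :
    ((S.encard : ℕ∞) : ℝ≥0∞) / ((S.encard : ℕ∞) : ℝ≥0∞) = 0 := by
  rw [not_and_or] at h
  rcases h with h | h
  · rw [Set.not_nonempty_iff_eq_empty] at h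
    rw [h, Set.encard_empty, ENat.toENNReal_zero, ENNReal.zero_div]
  · rw [Set.encard_eq_top_iff.2 h, ENat.toENNReal_top, ENNReal.div_top]

/-- The event `{z ∈ L_s ∩ C_ℍ(x)}` is measurable. [folklore] -/
theorem measurableSet_mem_layer [NeZero d] (s : ℤ) (x z : Site d) :
    MeasurableSet {ω : BondConfig (Site d) | z 0 = s ∧
      z ∈ openClusterIn (withinGraph (zdGraph d) (halfSpace d)) ω x} := by
  by_cases hz : z 0 = s
  · simp only [hz, true_and]
    exact measurableSet_openConnVia (withinGraph (zdGraph d) (halfSpace d)) x z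
  · simp only [hz, false_and, Set.setOf_false, MeasurableSet.empty]

/-- `ω ↦ |L_s ∩ C_ℍ^ω(x)|` is measurable. [folklore] -/
theorem measurable_encard_layer [NeZero d] (s : ℤ) (x : Site d) :
    Measurable fun ω : BondConfig (Site d) =>
      ((({z : Site d | z 0 = s} ∩
        openClusterIn (withinGraph (zdGraph d) (halfSpace d)) ω x).encard : ℕ∞) : ℝ≥0∞) := by
  have h : (fun ω : BondConfig (Site d) =>
      ((({z : Site d | z 0 = s} ∩
        openClusterIn (withinGraph (zdGraph d) (halfSpace d)) ω x).encard : ℕ∞) : ℝ≥0∞)) =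
      fun ω => ∑' z, {ω' : BondConfig (Site d) | z 0 = s ∧
        z ∈ openClusterIn (withinGraph (zdGraph d) (halfSpace d)) ω' x}.indicator
          (fun _ => (1 : ℝ≥0∞)) ω := by
    classical
    funext ω
    rw [encard_eq_tsum_indicator]
    refine tsum_congr fun z => ?_
    simp only [Set.indicator_apply, Set.mem_inter_iff, Set.mem_setOf_eq]
  rw [h]
  exact Measurable.tsum fun z => measurable_const.indicator (measurableSet_mem_layer s x z)

/-- The footprint event `{L_0 ∩ C_ℍ(x) nonempty and finite}` is measurable. [folklore] -/
theorem measurableSet_footprint [NeZero d] (x : Site d) :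
    MeasurableSet {ω : BondConfig (Site d) |
      ({z : Site d | z 0 = 0} ∩ openClusterIn (withinGraph (zdGraph d) (halfSpace d)) ω x).Nonempty ∧
      ({z : Site d | z 0 = 0} ∩ openClusterIn (withinGraph (zdGraph d) (halfSpace d)) ω x).Finite} := by
  have h : {ω : BondConfig (Site d) |
      ({z : Site d | z 0 = 0} ∩ openClusterIn (withinGraph (zdGraph d) (halfSpace d)) ω x).Nonempty ∧
      ({z : Site d | z 0 = 0} ∩ openClusterIn (withinGraph (zdGraph d) (halfSpace d)) ω x).Finite} =
      (fun ω : BondConfig (Site d) => ((({z : Site d | z 0 = 0} ∩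
        openClusterIn (withinGraph (zdGraph d) (halfSpace d)) ω x).encard : ℕ∞) : ℝ≥0∞)) ⁻¹'
        Set.Ioo 0 ⊤ := by
    ext ω
    simp only [Set.mem_setOf_eq, Set.mem_preimage, Set.mem_Ioo, pos_iff_ne_zero, lt_top_iff_ne_top,
      ne_eq, ENat.toENNReal_eq_zero, ENat.toENNReal_eq_top, Set.encard_eq_zero,
      Set.encard_eq_top_iff, Set.not_infinite, Set.nonempty_iff_ne_empty]
  rw [h]
  exact measurable_encard_layer 0 x measurableSet_Ioo

/-! ## The transport identity (every `d`, every `p`) -/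

/-- **Mushroom transport identity.** For every `d`, `p` and `x ∈ ℤ^d`:
`∫⁻ |L_0 ∩ C_ℍ(x)| / |L_0 ∩ C_ℍ(x)| dP_p = ∫⁻ |L_{x₀} ∩ C_ℍ(0)| / |L_0 ∩ C_ℍ(0)| dP_p`
(cardinalities in `ℝ≥0∞`). Mass transport for the translations of `ℤ^d` parallel to `∂ℍ`:
Tonelli, invariance of `P_p` and of `C_ℍ` under `ω ↦ ω + y` (`y₀ = 0`), and the reindexing
`y ↦ x - y` of the layer. [cite: LyonsPeres2016, §8.1 ((8.4))] -/
theorem lintegral_transport [NeZero d] (p : unitInterval) (x : Site d) :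
    ∫⁻ ω, ((({z : Site d | z 0 = 0} ∩
        openClusterIn (withinGraph (zdGraph d) (halfSpace d)) ω x).encard : ℕ∞) : ℝ≥0∞) /
      ((({z : Site d | z 0 = 0} ∩
        openClusterIn (withinGraph (zdGraph d) (halfSpace d)) ω x).encard : ℕ∞) : ℝ≥0∞)
      ∂(bondPercolation (zdGraph d) p) =
    ∫⁻ ω, ((({z : Site d | z 0 = x 0} ∩
        openClusterIn (withinGraph (zdGraph d) (halfSpace d)) ω 0).encard : ℕ∞) : ℝ≥0∞) /
      ((({z : Site d | z 0 = 0} ∩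
        openClusterIn (withinGraph (zdGraph d) (halfSpace d)) ω 0).encard : ℕ∞) : ℝ≥0∞)
      ∂(bondPercolation (zdGraph d) p) := by
  classical
  -- `F y ω`: the mass sent by `x` to `y`; `G z ω`: the mass received by `0` from `z`
  set F : Site d → BondConfig (Site d) → ℝ≥0∞ := fun y ω =>
    {ω' : BondConfig (Site d) | y 0 = 0 ∧
      y ∈ openClusterIn (withinGraph (zdGraph d) (halfSpace d)) ω' x}.indicator
      (fun ω' => (((({z : Site d | z 0 = 0} ∩
        openClusterIn (withinGraph (zdGraph d) (halfSpace d)) ω' x).encard : ℕ∞) : ℝ≥0∞))⁻¹) ω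
    with hF
  set G : Site d → BondConfig (Site d) → ℝ≥0∞ := fun y ω =>
    {ω' : BondConfig (Site d) | y 0 = x 0 ∧
      y ∈ openClusterIn (withinGraph (zdGraph d) (halfSpace d)) ω' 0}.indicator
      (fun ω' => (((({z : Site d | z 0 = 0} ∩
        openClusterIn (withinGraph (zdGraph d) (halfSpace d)) ω' 0).encard : ℕ∞) : ℝ≥0∞))⁻¹) ω
    with hG
  have hFm : ∀ y, Measurable (F y) := fun y =>
    (measurable_encard_layer 0 x).inv.indicator (measurableSet_mem_layer 0 x y)
  have hGm : ∀ y, Measurable (G y) := fun y =>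
    (measurable_encard_layer 0 0).inv.indicator (measurableSet_mem_layer (x 0) 0 y)
  -- Step 1: the integrand on the left is the total mass sent out by `x`
  have h1 : ∀ ω, ((({z : Site d | z 0 = 0} ∩
        openClusterIn (withinGraph (zdGraph d) (halfSpace d)) ω x).encard : ℕ∞) : ℝ≥0∞) /
      ((({z : Site d | z 0 = 0} ∩
        openClusterIn (withinGraph (zdGraph d) (halfSpace d)) ω x).encard : ℕ∞) : ℝ≥0∞) =
      ∑' y, F y ω := by
    intro ω
    rw [div_eq_mul_inv]
    nth_rw 1 [encard_eq_tsum_indicator]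
    rw [← ENNReal.tsum_mul_right]
    refine tsum_congr fun y => ?_
    simp only [hF, Set.indicator_apply, Set.mem_inter_iff, Set.mem_setOf_eq]
    split_ifs <;> simp_all
  -- Step 2: invariance moves each summand to the origin
  have h3 : ∀ y, ∫⁻ ω, F y ω ∂bondPercolation (zdGraph d) p =
      ∫⁻ ω, G (x - y) ω ∂bondPercolation (zdGraph d) p := by
    intro y
    by_cases hy : y 0 = 0
    · calc ∫⁻ ω, F y ω ∂bondPercolation (zdGraph d) p
            = ∫⁻ ω, F y ω ∂(bondPercolation (zdGraph d) p).map
                (BondConfig.relabel (sym2Equiv (Site.shift y))) := by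
              rw [bondPercolation_map_shift]
          _ = ∫⁻ ω, F y (BondConfig.relabel (sym2Equiv (Site.shift y)) ω)
                ∂bondPercolation (zdGraph d) p :=
              lintegral_map (hFm y) (BondConfig.relabel (sym2Equiv (Site.shift y))).measurable
          _ = ∫⁻ ω, G (x - y) ω ∂bondPercolation (zdGraph d) p := lintegral_congr fun ω => ?_
      have hmem : y ∈ openClusterIn (withinGraph (zdGraph d) (halfSpace d))
          (BondConfig.relabel (sym2Equiv (Site.shift y)) ω) x ↔
          x - y ∈ openClusterIn (withinGraph (zdGraph d) (halfSpace d)) ω 0 := by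
        rw [openClusterIn_halfSpace_shift y hy ω x, Set.mem_image]
        constructor
        · rintro ⟨w, hw, hwy⟩
          have hw0 : w = 0 := add_right_cancel (hwy.trans (zero_add y).symm)
          rw [hw0] at hw
          exact mem_openClusterIn_comm.1 hw
        · intro h
          exact ⟨0, mem_openClusterIn_comm.1 h, zero_add y⟩
      have hx0 : (x - y) 0 = x 0 := by rw [Pi.sub_apply, hy, sub_zero]
      by_cases hxy : x - y ∈ openClusterIn (withinGraph (zdGraph d) (halfSpace d)) ω 0
      · have hin : BondConfig.relabel (sym2Equiv (Site.shift y)) ω ∈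
            {ω' : BondConfig (Site d) | y 0 = 0 ∧
              y ∈ openClusterIn (withinGraph (zdGraph d) (halfSpace d)) ω' x} := ⟨hy, hmem.2 hxy⟩
        have hin' : ω ∈ {ω' : BondConfig (Site d) | (x - y) 0 = x 0 ∧
            x - y ∈ openClusterIn (withinGraph (zdGraph d) (halfSpace d)) ω' 0} := ⟨hx0, hxy⟩
        simp only [hF, hG, Set.indicator_of_mem hin, Set.indicator_of_mem hin']
        rw [encard_layer_shift y hy ω x 0, openClusterIn_eq_of_mem hxy]
      · have hout : BondConfig.relabel (sym2Equiv (Site.shift y)) ω ∉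
            {ω' : BondConfig (Site d) | y 0 = 0 ∧
              y ∈ openClusterIn (withinGraph (zdGraph d) (halfSpace d)) ω' x} :=
          fun h => hxy (hmem.1 h.2)
        have hout' : ω ∉ {ω' : BondConfig (Site d) | (x - y) 0 = x 0 ∧
            x - y ∈ openClusterIn (withinGraph (zdGraph d) (halfSpace d)) ω' 0} :=
          fun h => hxy h.2
        simp only [hF, hG, Set.indicator_of_notMem hout, Set.indicator_of_notMem hout']
    · have hF0 : ∀ ω, F y ω = 0 := fun ω =>
        Set.indicator_of_notMem (s := {ω' : BondConfig (Site d) | y 0 = 0 ∧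
          y ∈ openClusterIn (withinGraph (zdGraph d) (halfSpace d)) ω' x}) (fun h => hy h.1) _
      have hne : (x - y) 0 ≠ x 0 := by
        rw [Pi.sub_apply]
        intro h
        exact hy (by omega)
      have hG0 : ∀ ω, G (x - y) ω = 0 := fun ω =>
        Set.indicator_of_notMem (s := {ω' : BondConfig (Site d) | (x - y) 0 = x 0 ∧
          x - y ∈ openClusterIn (withinGraph (zdGraph d) (halfSpace d)) ω' 0}) (fun h => hne h.1) _
      simp only [hF0, hG0]
  -- Step 3: reindex the layer by `y ↦ x - y` and resum
  have h4 : ∑' y, ∫⁻ ω, G (x - y) ω ∂bondPercolation (zdGraph d) p =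
      ∑' z, ∫⁻ ω, G z ω ∂bondPercolation (zdGraph d) p :=
    (Equiv.subLeft x).tsum_eq fun z => ∫⁻ ω, G z ω ∂bondPercolation (zdGraph d) p
  have h6 : ∀ ω, ∑' z, G z ω = ((({z : Site d | z 0 = x 0} ∩
        openClusterIn (withinGraph (zdGraph d) (halfSpace d)) ω 0).encard : ℕ∞) : ℝ≥0∞) /
      ((({z : Site d | z 0 = 0} ∩
        openClusterIn (withinGraph (zdGraph d) (halfSpace d)) ω 0).encard : ℕ∞) : ℝ≥0∞) := by
    intro ω
    rw [div_eq_mul_inv, encard_eq_tsum_indicator ({z : Site d | z 0 = x 0} ∩ _),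
      ← ENNReal.tsum_mul_right]
    refine tsum_congr fun z => ?_
    simp only [hG, Set.indicator_apply, Set.mem_inter_iff, Set.mem_setOf_eq]
    split_ifs <;> simp_all
  calc _ = ∫⁻ ω, ∑' y, F y ω ∂bondPercolation (zdGraph d) p := lintegral_congr fun ω => h1 ω
    _ = ∑' y, ∫⁻ ω, F y ω ∂bondPercolation (zdGraph d) p :=
        lintegral_tsum fun y => (hFm y).aemeasurable
    _ = ∑' y, ∫⁻ ω, G (x - y) ω ∂bondPercolation (zdGraph d) p := tsum_congr h3
    _ = ∑' z, ∫⁻ ω, G z ω ∂bondPercolation (zdGraph d) p := h4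
    _ = ∫⁻ ω, ∑' z, G z ω ∂bondPercolation (zdGraph d) p :=
        (lintegral_tsum fun z => (hGm z).aemeasurable).symm
    _ = _ := lintegral_congr fun ω => h6 ω

/-- The left side of the transport identity is the probability of the footprint event:
`∫⁻ |L_0 ∩ C_ℍ(x)| / |L_0 ∩ C_ℍ(x)| dP_p = P_p(L_0 ∩ C_ℍ(x) is nonempty and finite)`. [folklore] -/
theorem lintegral_encard_div_self [NeZero d] (p : unitInterval) (x : Site d) :
    ∫⁻ ω, ((({z : Site d | z 0 = 0} ∩
        openClusterIn (withinGraph (zdGraph d) (halfSpace d)) ω x).encard : ℕ∞) : ℝ≥0∞) /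
      ((({z : Site d | z 0 = 0} ∩
        openClusterIn (withinGraph (zdGraph d) (halfSpace d)) ω x).encard : ℕ∞) : ℝ≥0∞)
      ∂(bondPercolation (zdGraph d) p) =
    bondPercolation (zdGraph d) p {ω |
      ({z : Site d | z 0 = 0} ∩ openClusterIn (withinGraph (zdGraph d) (halfSpace d)) ω x).Nonempty ∧
      ({z : Site d | z 0 = 0} ∩ openClusterIn (withinGraph (zdGraph d) (halfSpace d)) ω x).Finite} := by
  rw [← lintegral_indicator_one (measurableSet_footprint x)]
  refine lintegral_congr fun ω => ?_
  by_cases h :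
      ({z : Site d | z 0 = 0} ∩ openClusterIn (withinGraph (zdGraph d) (halfSpace d)) ω x).Nonempty ∧
      ({z : Site d | z 0 = 0} ∩ openClusterIn (withinGraph (zdGraph d) (halfSpace d)) ω x).Finite
  · rw [encard_div_self_eq_one h.1 h.2, Set.indicator_of_mem (by exact h), Pi.one_apply]
  · rw [encard_div_self_eq_zero h, Set.indicator_of_notMem (by exact h)]

/-- **Transport identity, probabilistic form** (every `d`, `p`, `x`):
`P_p(L_0 ∩ C_ℍ(x) is nonempty and finite) = E_p[|L_{x₀} ∩ C_ℍ(0)| / |L_0 ∩ C_ℍ(0)|]`.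
[cite: LyonsPeres2016, §8.1 ((8.4))] -/
theorem measure_footprint_eq_lintegral_layerRatio [NeZero d] (p : unitInterval) (x : Site d) :
    bondPercolation (zdGraph d) p {ω |
      ({z : Site d | z 0 = 0} ∩ openClusterIn (withinGraph (zdGraph d) (halfSpace d)) ω x).Nonempty ∧
      ({z : Site d | z 0 = 0} ∩ openClusterIn (withinGraph (zdGraph d) (halfSpace d)) ω x).Finite} =
    ∫⁻ ω, ((({z : Site d | z 0 = x 0} ∩
        openClusterIn (withinGraph (zdGraph d) (halfSpace d)) ω 0).encard : ℕ∞) : ℝ≥0∞) /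
      ((({z : Site d | z 0 = 0} ∩
        openClusterIn (withinGraph (zdGraph d) (halfSpace d)) ω 0).encard : ℕ∞) : ℝ≥0∞)
      ∂(bondPercolation (zdGraph d) p) := by
  rw [← lintegral_encard_div_self, lintegral_transport]

/-- In particular the expected layer ratio never exceeds `1`:
`E_p[|L_s ∩ C_ℍ(0)| / |L_0 ∩ C_ℍ(0)|] ≤ 1` for every layer `s`. [folklore] -/
theorem lintegral_layerRatio_le_one [NeZero d] (p : unitInterval) (s : ℤ) :
    ∫⁻ ω, ((({z : Site d | z 0 = s} ∩
        openClusterIn (withinGraph (zdGraph d) (halfSpace d)) ω 0).encard : ℕ∞) : ℝ≥0∞) /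
      ((({z : Site d | z 0 = 0} ∩
        openClusterIn (withinGraph (zdGraph d) (halfSpace d)) ω 0).encard : ℕ∞) : ℝ≥0∞)
      ∂(bondPercolation (zdGraph d) p) ≤ 1 := by
  have h := measure_footprint_eq_lintegral_layerRatio p (Pi.single (0 : Fin d) s)
  simp only [Pi.single_eq_same] at h
  rw [← h]
  exact prob_le_one

end Mushroom

end Summit.CriticalPhenomena.PercolationContinuityZ3.Theorems

end
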